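import Literature.Probability.RandomPlanarGeometry.YangBaxterSAWGeneralDomain
import Literature.Probability.RandomPlanarGeometry.YangBaxterSAWYBE
import Mathlib.Analysis.Analytic.IsolatedZeros
import Mathlib.Analysis.SpecialFunctions.Trigonometric.Deriv
import Mathlib.Analysis.SpecialFunctions.ExpDeriv
import HarnessLib

/-!
# Barrier catalogue (SAWScalingLimit): the printed Yang–Baxter vertex functional is REAL-ANALYTIC in the angle —
its zero set on the printed range is finite or everything

The printed weights `u₁, u₂, v, w₁, w₂` of [GlazmanManolescu2019, eq. (1)] are quotients of products of sines of
affine functions of the rhombus angle `θ`, with the common denominator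
`weightDen θ = sin(5π/4 + 3θ/8)·sin(5π/8 − 3θ/8)`, non-zero on `(0, π)` (tree: `weightDen_ne_zero_of_mem_Ioo`); the
contour coefficient `r(θ) = e^{i(3θ/8 + 5π/16)}` is entire. Hence, for every finite face list `Dl`, root `a` and
plaquette `f₀`, the map `θ ↦ VF_{Dl}(a, f₀; θ) = vertexFunctional (printedWeights θ) tFiveEighths (ybCoeff θ) Dl a f₀`
— a finite sum over walks of weight monomials times `θ`-independent phases — is real-analytic on `(0, π)`
(`analyticOnNhd_vertexFunctional_printed`). By the identity principle (Mathlib,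
`AnalyticOnNhd.eqOn_zero_of_preconnected_of_frequently_eq_zero`):

* `vertexFunctional_printed_eqOn_zero_of_frequently_eq_zero` — if the defect vanishes at angles accumulating at some
  `θ₀ ∈ (0, π)`, it vanishes at every `θ ∈ (0, π)`;
* ★ `vertexFunctional_printed_zero_set_finite_or_forall` — DICHOTOMY: either `VF(θ) = 0` for every `θ ∈ (0, π)`, or
  the set of zeros in the printed range `[π/3, 2π/3]` is FINITE;
* `vertexFunctional_printed_zero_set_finite_of_exists_ne_zero` — one angle in `(0, π)` with `VF ≠ 0` ⇒ finitely many
  zeros in `[π/3, 2π/3]`.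

Use (venture lane «pcv-sawmu», FINDING-YB-ENCIRCLING-CRITERION STATUS BLOCK 9): the open sufficient half of the
encircling criterion at a general plaquette must be stated as «VF ≢ 0 on the range» because of the mirror zeros at
`θ = π/2`; this file makes «≢ 0» precise and equivalent to «≠ 0 for all but finitely many θ ∈ [π/3, 2π/3]», and shows
that every exact zero of a not-identically-vanishing defect (e.g. the (R-9′) mirror zeros) is an ISOLATED angle.
Elementary (analyticity + identity principle); recorded because the lane's statements quantify over θ.
-/

noncomputable section

namespace Literature.Barriers.CriticalPhenomena.PlaquetteWalk

open Literature.Probability.RandomPlanarGeometry.SAW.YangBaxter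
open Real Complex Filter Set Topology

/-! ## Analyticity of the printed weights -/

section Weights

/-- The inclusion `ℝ → ℂ` is real-analytic. [folklore] -/
private theorem analyticAt_ofReal' (x : ℝ) : AnalyticAt ℝ (fun y : ℝ => (y : ℂ)) x := by
  have e : (fun y : ℝ => (y : ℂ)) = ⇑Complex.ofRealCLM := by ext y; simp
  rw [e]; exact Complex.ofRealCLM.analyticAt x

/-- `u₁` is real-analytic where the denominator of eq. (1) does not vanish. [cite: GlazmanManolescu2019, §1, eq. (1)] -/
theorem analyticAt_weightU1 {θ : ℝ} (h : weightDen θ ≠ 0) : AnalyticAt ℝ weightU1 θ := by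
  have e : weightU1 = fun θ => Real.sin (5 * π / 4) * Real.sin (5 * π / 8 + 3 * θ / 8) /
      (Real.sin (5 * π / 4 + 3 * θ / 8) * Real.sin (5 * π / 8 - 3 * θ / 8)) := by
    funext x; simp [weightU1, weightDen]
  rw [e]; simp only [weightDen] at h
  fun_prop (disch := exact h)

/-- `u₂` is real-analytic where the denominator does not vanish. [cite: GlazmanManolescu2019, §1, eq. (1)] -/
theorem analyticAt_weightU2 {θ : ℝ} (h : weightDen θ ≠ 0) : AnalyticAt ℝ weightU2 θ := by
  have e : weightU2 = fun θ => Real.sin (5 * π / 4) * Real.sin (3 * θ / 8) /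
      (Real.sin (5 * π / 4 + 3 * θ / 8) * Real.sin (5 * π / 8 - 3 * θ / 8)) := by
    funext x; simp [weightU2, weightDen]
  rw [e]; simp only [weightDen] at h
  fun_prop (disch := exact h)

/-- `v` is real-analytic where the denominator does not vanish. [cite: GlazmanManolescu2019, §1, eq. (1)] -/
theorem analyticAt_weightV {θ : ℝ} (h : weightDen θ ≠ 0) : AnalyticAt ℝ weightV θ := by
  have e : weightV = fun θ => Real.sin (5 * π / 8 + 3 * θ / 8) * Real.sin (-(3 * θ / 8)) /
      (Real.sin (5 * π / 4 + 3 * θ / 8) * Real.sin (5 * π / 8 - 3 * θ / 8)) := by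
    funext x; simp [weightV, weightDen]
  rw [e]; simp only [weightDen] at h
  fun_prop (disch := exact h)

/-- `w₁` is real-analytic where the denominator does not vanish. [cite: GlazmanManolescu2019, §1, eq. (1)] -/
theorem analyticAt_weightW1 {θ : ℝ} (h : weightDen θ ≠ 0) : AnalyticAt ℝ weightW1 θ := by
  have e : weightW1 = fun θ => Real.sin (5 * π / 8 + 3 * θ / 8) * Real.sin (5 * π / 4 - 3 * θ / 8) /
      (Real.sin (5 * π / 4 + 3 * θ / 8) * Real.sin (5 * π / 8 - 3 * θ / 8)) := by
    funext x; simp [weightW1, weightDen]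
  rw [e]; simp only [weightDen] at h
  fun_prop (disch := exact h)

/-- `w₂` is real-analytic where the denominator does not vanish. [cite: GlazmanManolescu2019, §1, eq. (1)] -/
theorem analyticAt_weightW2 {θ : ℝ} (h : weightDen θ ≠ 0) : AnalyticAt ℝ weightW2 θ := by
  have e : weightW2 = fun θ => Real.sin (15 * π / 8 + 3 * θ / 8) * Real.sin (-(3 * θ / 8)) /
      (Real.sin (5 * π / 4 + 3 * θ / 8) * Real.sin (5 * π / 8 - 3 * θ / 8)) := by
    funext x; simp [weightW2, weightDen]
  rw [e]; simp only [weightDen] at h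
  fun_prop (disch := exact h)

/-- The contour coefficient `r(θ) = e^{i(3θ/8 + 5π/16)}` is real-analytic in `θ`. [cite: GlazmanManolescu2019, Lemma 2.1, eq. (CR)] -/
theorem analyticAt_ybRatio (θ : ℝ) : AnalyticAt ℝ ybRatio θ := by
  have e : ybRatio = fun θ : ℝ => Complex.exp ((((3 * θ / 8 + 5 * π / 16 : ℝ)) : ℂ) * I) := by
    funext x; simp [ybRatio]
  rw [e]
  have hin : AnalyticAt ℝ (fun θ : ℝ => (((3 * θ / 8 + 5 * π / 16 : ℝ)) : ℂ) * I) θ :=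
    ((analyticAt_ofReal' _).comp (by fun_prop)).mul analyticAt_const
  exact (analyticAt_cexp.restrictScalars (𝕜 := ℝ)).comp hin

/-- Each slot coefficient `c_s(θ) ∈ {1, r(θ), −1, −r(θ)}` is real-analytic in `θ`. [cite: GlazmanManolescu2019, Lemma 2.1, eq. (CR)] -/
theorem analyticAt_ybCoeff (s : Fin 4) (θ : ℝ) : AnalyticAt ℝ (fun θ => ybCoeff θ s) θ := by
  fin_cases s
  · simp only [ybCoeff, Fin.zero_eta, Matrix.cons_val_zero]; exact analyticAt_const
  · simp only [ybCoeff, Fin.mk_one, Matrix.cons_val_one, Matrix.cons_val_zero]; exact analyticAt_ybRatio θ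
  · simp only [ybCoeff, Fin.reduceFinMk, Matrix.cons_val]; exact analyticAt_const
  · simp only [ybCoeff, Fin.reduceFinMk, Matrix.cons_val]; exact (analyticAt_ybRatio θ).neg

end Weights

/-! ## Analyticity of the observable and of the vertex functional -/

section Functional

/-- The weight monomial of a mid-edge list under the printed weights is real-analytic in `θ` where the denominator does
not vanish. [cite: GlazmanManolescu2019, §1 ("the weight of a walk is the product of weights associated to each rhombus")] -/
theorem analyticAt_weightL_printed (l : List MidEdge) {θ : ℝ} (h : weightDen θ ≠ 0) :
    AnalyticAt ℝ (fun θ => weightL (printedWeights θ) l) θ := by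
  have h1 := (analyticAt_ofReal' _).comp (analyticAt_weightU1 h)
  have h2 := (analyticAt_ofReal' _).comp (analyticAt_weightU2 h)
  have h3 := (analyticAt_ofReal' _).comp (analyticAt_weightV h)
  have h4 := (analyticAt_ofReal' _).comp (analyticAt_weightW1 h)
  have h5 := (analyticAt_ofReal' _).comp (analyticAt_weightW2 h)
  simp only [Function.comp_def] at h1 h2 h3 h4 h5
  simp only [weightL, CWeights.mono, printedWeights]
  exact ((((h1.pow _).mul (h2.pow _)).mul (h3.pow _)).mul (h4.pow _)).mul (h5.pow _)

/-- **The printed parafermionic observable is real-analytic in the angle** (where the denominator does not vanish).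
[cite: GlazmanManolescu2019, §2.1, eq. (2.1) and eq. (1)] -/
theorem analyticAt_gmObservable_printed (Dl : List Face) (a z : MidEdge) {θ : ℝ} (h : weightDen θ ≠ 0) :
    AnalyticAt ℝ (fun θ => gmObservable (printedWeights θ) tFiveEighths Dl a z) θ := by
  simp only [gmObservable]
  exact Finset.analyticAt_fun_sum _ fun γ _ => (analyticAt_weightL_printed γ.mids h).mul analyticAt_const

/-- ★ **The printed Yang–Baxter vertex functional is real-analytic in the angle** (where the denominator of eq. (1)
does not vanish). [cite: GlazmanManolescu2019, Lemma 2.1 and eq. (1)] -/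
theorem analyticAt_vertexFunctional_printed (Dl : List Face) (a : MidEdge) (f₀ : Face) {θ : ℝ}
    (h : weightDen θ ≠ 0) :
    AnalyticAt ℝ (fun θ => vertexFunctional (printedWeights θ) tFiveEighths (ybCoeff θ) Dl a f₀) θ := by
  simp only [vertexFunctional]
  exact Finset.analyticAt_fun_sum _ fun s _ =>
    (analyticAt_ybCoeff s θ).mul (analyticAt_gmObservable_printed Dl a _ h)

/-- ★ **Analytic on `(0, π)`.** [cite: GlazmanManolescu2019, Lemma 2.1 and eq. (1)] -/
theorem analyticOnNhd_vertexFunctional_printed (Dl : List Face) (a : MidEdge) (f₀ : Face) :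
    AnalyticOnNhd ℝ (fun θ => vertexFunctional (printedWeights θ) tFiveEighths (ybCoeff θ) Dl a f₀)
      (Set.Ioo 0 π) :=
  fun _ hθ => analyticAt_vertexFunctional_printed Dl a f₀ (weightDen_ne_zero_of_mem_Ioo hθ)

end Functional

/-! ## The zero set in the angle: identity principle and the finite-or-everything dichotomy -/

section ZeroSet

/-- ★★ **IDENTITY PRINCIPLE FOR THE DEFECT.** If the printed vertex functional of `(Dl, a, f₀)` vanishes at angles
accumulating at some `θ₀ ∈ (0, π)`, it vanishes at every angle of `(0, π)`.
[cite: GlazmanManolescu2019, Lemma 2.1 and eq. (1)] -/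
theorem vertexFunctional_printed_eqOn_zero_of_frequently_eq_zero (Dl : List Face) (a : MidEdge) (f₀ : Face)
    {θ₀ : ℝ} (h₀ : θ₀ ∈ Set.Ioo 0 π)
    (h : ∃ᶠ θ in 𝓝[≠] θ₀, vertexFunctional (printedWeights θ) tFiveEighths (ybCoeff θ) Dl a f₀ = 0) :
    ∀ θ ∈ Set.Ioo 0 π, vertexFunctional (printedWeights θ) tFiveEighths (ybCoeff θ) Dl a f₀ = 0 :=
  fun _ hθ => (analyticOnNhd_vertexFunctional_printed Dl a f₀).eqOn_zero_of_preconnected_of_frequently_eq_zero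
    isPreconnected_Ioo h₀ h hθ

/-- ★★★ **FINITE OR EVERYTHING.** For every face list, root and plaquette: either the printed vertex functional
vanishes at EVERY angle of `(0, π)`, or its zeros in the printed range `[π/3, 2π/3]` are FINITELY many.
[cite: GlazmanManolescu2019, Lemma 2.1 and eq. (1)] -/
theorem vertexFunctional_printed_zero_set_finite_or_forall (Dl : List Face) (a : MidEdge) (f₀ : Face) :
    {θ ∈ Set.Icc (π / 3) (2 * π / 3) |
        vertexFunctional (printedWeights θ) tFiveEighths (ybCoeff θ) Dl a f₀ = 0}.Finite ∨
      ∀ θ ∈ Set.Ioo 0 π, vertexFunctional (printedWeights θ) tFiveEighths (ybCoeff θ) Dl a f₀ = 0 := by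
  by_contra hc
  push Not at hc
  obtain ⟨hinf, θ₁, hθ₁, hne⟩ := hc
  obtain ⟨x, hxK, hx⟩ := Set.Infinite.exists_accPt_of_subset_isCompact hinf isCompact_Icc (fun θ hθ => hθ.1)
  have hx0 : x ∈ Set.Ioo 0 π :=
    ⟨by linarith [hxK.1, Real.pi_pos], by linarith [hxK.2, Real.pi_pos]⟩
  have hfr : ∃ᶠ θ in 𝓝[≠] x, vertexFunctional (printedWeights θ) tFiveEighths (ybCoeff θ) Dl a f₀ = 0 :=
    (accPt_iff_frequently_nhdsNE.1 hx).mono fun θ hθ => hθ.2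
  exact hne (vertexFunctional_printed_eqOn_zero_of_frequently_eq_zero Dl a f₀ hx0 hfr θ₁ hθ₁)

/-- ★★ **One non-zero angle ⇒ finitely many zeros in the printed range** — «VF ≢ 0» is the same as «VF(θ) ≠ 0 for
all but finitely many θ ∈ [π/3, 2π/3]». [cite: GlazmanManolescu2019, Lemma 2.1 and eq. (1)] -/
theorem vertexFunctional_printed_zero_set_finite_of_exists_ne_zero (Dl : List Face) (a : MidEdge) (f₀ : Face)
    (h : ∃ θ ∈ Set.Ioo 0 π, vertexFunctional (printedWeights θ) tFiveEighths (ybCoeff θ) Dl a f₀ ≠ 0) :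
    {θ ∈ Set.Icc (π / 3) (2 * π / 3) |
        vertexFunctional (printedWeights θ) tFiveEighths (ybCoeff θ) Dl a f₀ = 0}.Finite := by
  rcases vertexFunctional_printed_zero_set_finite_or_forall Dl a f₀ with hfin | hall
  · exact hfin
  · obtain ⟨θ, hθ, hne⟩ := h
    exact absurd (hall θ hθ) hne

/-- **Infinitely many zeros in the printed range ⇒ identically zero on `(0, π)`** (contrapositive form).
[cite: GlazmanManolescu2019, Lemma 2.1 and eq. (1)] -/
theorem vertexFunctional_printed_forall_eq_zero_of_infinite (Dl : List Face) (a : MidEdge) (f₀ : Face)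
    (h : {θ ∈ Set.Icc (π / 3) (2 * π / 3) |
        vertexFunctional (printedWeights θ) tFiveEighths (ybCoeff θ) Dl a f₀ = 0}.Infinite) :
    ∀ θ ∈ Set.Ioo 0 π, vertexFunctional (printedWeights θ) tFiveEighths (ybCoeff θ) Dl a f₀ = 0 := by
  rcases vertexFunctional_printed_zero_set_finite_or_forall Dl a f₀ with hfin | hall
  · exact absurd hfin h
  · exact hall

end ZeroSet

end Literature.Barriers.CriticalPhenomena.PlaquetteWalk
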